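import Literature.Geometry.Lorentzian.ObstructionFreeGluing
import Mathlib.Analysis.SpecialFunctions.SmoothTransition
import HarnessLib

/-!
# Obstruction-free annular gluing (Mao–Oh–Tao 2023): the proved tree-side outer layer

Companion ("Proofs") file of `ObstructionFreeGluing.lean`, which states Mao–Oh–Tao, arXiv:2308.13031, Thm 1.7 with Rem 1.9
as the named fact `MaoOhTao.ObstructionFreeAnnularGluing` over the tree's `InitialDataSet (𝓡 3) E3` [MaoOhTao2023].

The printed theorem delivers a pair `(g, k)` on the annulus `B_64 ∖ B̄_1` solving the vacuum constraints and agreeing with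
the in/out data on the open annuli `A_1 = {1 < |x| < 2}`, `A_32 = {32 < |x| < 64}` ((1.21)); the fact's conclusion asks
for ONE smooth datum on `ℝ³` that solves the constraints on `{1 < |x| < 64}`, IS the in-datum on `B_2` and IS the out-datum
outside `B̄_32`.  This file proves, once and for all, the elementary passage between the two (everything here is a theorem;
no definitions, no named facts):

* `InitialDataSet.SameAt.refl/symm/trans` — "same sections at `y`" is an equivalence relation;
* `InitialDataSet.VacOn.mono`, `InitialDataSet.VacOn.congr` — the vacuum constraints on an open annulus restrict to smaller
  annuli and only see the GERMS of `(h, k)` there (Bartnik–Isenberg 2004, §2, via `isVacuumAt_congr` of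
  `InitialDataLocality.lean`; the Levi-Civita hypothesis is discharged by `PseudoRiemannianMetric.hasLeviCivita`);
* `InitialDataSet.exists_patch` — RADIAL PATCHING: two smooth data on `ℝ³` with the same sections on an open shell
  `{ρ₁ < |y| < ρ₂}` patch, across any intermediate radius, to a smooth datum equal to the first on `B_{ρ₂}` and to the
  second outside `B̄_{ρ₁}` (smoothness of a section is local, `ContMDiffAt.congr_of_eventuallyEq`);
* `MaoOhTao.assembly` — a datum on `ℝ³` solving the constraints on `{1 < |x| < 64}` with the sections of `Din` on `A_1` and
  of `Dout` on `A_32` yields the conclusion of `ObstructionFreeAnnularGluing` verbatim (two patchings + locality);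
* `MaoOhTao.exists_isBump` — the bump hypothesis of the fact is not vacuous: an `η ∈ C^∞`, `supp η ⊆ [1, 2]`, `∫ η = 1`
  exists (`expNegInvGlue(s − 1) · expNegInvGlue(2 − s)`, normalised).

What is NOT here: the analytic content of Thm 1.7 itself (Bogovskii/conic solution operators, Picard iteration in
`H^s × H^{s-1}`, multi-bump data with prescribed charges, localized boosts), i.e. the discharge
`ObstructionFreeAnnularGluing_holds`; `assembly` isolates exactly what it must produce: a smooth datum `Dmid` on `ℝ³` with
`Dmid.VacOn 1 64` agreeing with the in/out data on the open annuli.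

## References

* Y. Mao, S.-J. Oh, Z. Tao, arXiv:2308.13031 (2023), Thm 1.7, Rem 1.9, (1.21). [MaoOhTao2023]
* R. Bartnik, J. Isenberg, *The constraint equations* (2004), §2. [BartnikIsenberg2004]
-/

noncomputable section

namespace Literature.Geometry.Lorentzian

open scoped _root_.Manifold _root_.ContDiff

/-! ## §1 Same sections, locality of `VacOn`, radial patching -/

namespace InitialDataSet

open _root_.Filter _root_.Bundle
open scoped _root_.Topology

variable {D D' D'' : InitialDataSet (𝓡 3) E3} {y : E3}

/-- `SameAt` is reflexive. [folklore] -/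
theorem SameAt.refl (D : InitialDataSet (𝓡 3) E3) (y : E3) : D.SameAt D y := ⟨rfl, rfl⟩

/-- `SameAt` is symmetric. [folklore] -/
theorem SameAt.symm (h : D.SameAt D' y) : D'.SameAt D y := ⟨h.1.symm, h.2.symm⟩

/-- `SameAt` is transitive. [folklore] -/
theorem SameAt.trans (h : D.SameAt D' y) (h' : D'.SameAt D'' y) : D.SameAt D'' y :=
  ⟨h.1.trans h'.1, h.2.trans h'.2⟩

/-- The vacuum constraints on an open annulus hold on every smaller annulus. [folklore] -/
theorem VacOn.mono {a b a' b' : ℝ} (h : D.VacOn a b) (ha : a ≤ a') (hb : b' ≤ b) : D.VacOn a' b' := by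
  intro _ y hy1 hy2
  exact h y (lt_of_le_of_lt ha hy1) (lt_of_lt_of_le hy2 hb)

/-- **Locality of the vacuum constraints on an annulus**: if `D` has, near every point of the open annulus
`{a < |y| < b}`, the same sections as a datum `D'` solving the vacuum constraints there, then so does `D` (the constraint
functions at a point depend only on the germ of `(h, k)`, `isVacuumAt_congr`; the Levi-Civita hypothesis of `D'` is
discharged by `PseudoRiemannianMetric.hasLeviCivita`). Bartnik–Isenberg 2004, §2 (local character of the constraints).
[cite: BartnikIsenberg2004, §2] -/
theorem VacOn.congr {a b : ℝ} (h : D'.VacOn a b)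
    (hS : ∀ y : E3, a < ‖y‖ → ‖y‖ < b → ∀ᶠ z in 𝓝 y, D.SameAt D' z) : D.VacOn a b := by
  intro _ y hy1 hy2
  haveI := D'.metric.hasLeviCivita
  have hh : ∀ᶠ z in 𝓝 y, D.h.inner z = D'.h.inner z := (hS y hy1 hy2).mono fun z hz ↦ hz.1
  have hk : ∀ᶠ z in 𝓝 y, D.k z = D'.k z := (hS y hy1 hy2).mono fun z hz ↦ hz.2
  exact (isVacuumAt_congr hh hk).2 (h y hy1 hy2)

/-- Points near a point of the open shell `{a < |z| < b}` lie in the shell. [folklore] -/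
theorem eventually_norm_mem_Ioo {a b : ℝ} (ha : a < ‖y‖) (hb : ‖y‖ < b) :
    ∀ᶠ z in 𝓝 y, a < ‖z‖ ∧ ‖z‖ < b := by
  have h1 : ∀ᶠ z in 𝓝 y, a < ‖z‖ :=
    (isOpen_lt continuous_const continuous_norm).mem_nhds (by simpa using ha)
  have h2 : ∀ᶠ z in 𝓝 y, ‖z‖ < b :=
    (isOpen_lt continuous_norm continuous_const).mem_nhds (by simpa using hb)
  exact h1.and h2

/-- **Radial patching of initial data on `ℝ³`.** If two smooth data `D₁`, `D₂` on `ℝ³` have the same sections on the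
open shell `{ρ₁ < |y| < ρ₂}` and `ρ₁ < ρ < ρ₂`, then the datum "`D₁` on `{|y| < ρ}`, `D₂` on `{|y| ≥ ρ}`" is a smooth
initial data set on `ℝ³`: it agrees with `D₁` on the ball `{|y| < ρ₂}` and with `D₂` outside `B̄_{ρ₁}`, so near every
point it coincides with one of the two smooth data (smoothness of a section of a bundle is a local property,
`ContMDiffAt.congr_of_eventuallyEq`), and symmetry, positivity and boundedness of unit balls are pointwise. This is the
elementary patching step behind every annular gluing statement (Mao–Oh–Tao 2023, (1.21): "`(g, k) = (g_in, k_in)` in `A_1`,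
`= (g_out, k_out)` in `A_32`"). [folklore] -/
theorem exists_patch (D₁ D₂ : InitialDataSet (𝓡 3) E3) {ρ₁ ρ ρ₂ : ℝ} (h₁ : ρ₁ < ρ) (h₂ : ρ < ρ₂)
    (hS : ∀ y : E3, ρ₁ < ‖y‖ → ‖y‖ < ρ₂ → D₁.SameAt D₂ y) :
    ∃ D : InitialDataSet (𝓡 3) E3,
      (∀ y : E3, ‖y‖ < ρ₂ → D.SameAt D₁ y) ∧ (∀ y : E3, ρ₁ < ‖y‖ → D.SameAt D₂ y) := by
  classical
  set g : (y : E3) → (TangentSpace (𝓡 3) y →L[ℝ] TangentSpace (𝓡 3) y →L[ℝ] ℝ) :=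
    fun y ↦ if ‖y‖ < ρ then D₁.h.inner y else D₂.h.inner y with hg
  set κ : (y : E3) → (TangentSpace (𝓡 3) y →L[ℝ] TangentSpace (𝓡 3) y →L[ℝ] ℝ) :=
    fun y ↦ if ‖y‖ < ρ then D₁.k y else D₂.k y with hκ
  -- on the big ball the patched sections are those of `D₁`, outside the small ball those of `D₂`
  have hP : ∀ y : E3, ‖y‖ < ρ₂ → g y = D₁.h.inner y ∧ κ y = D₁.k y := by
    intro y hy
    by_cases hyρ : ‖y‖ < ρ
    · simp [hg, hκ, hyρ]
    · have h := hS y (by linarith [not_lt.1 hyρ]) hy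
      simp [hg, hκ, hyρ, h.1, h.2]
  have hQ : ∀ y : E3, ρ₁ < ‖y‖ → g y = D₂.h.inner y ∧ κ y = D₂.k y := by
    intro y hy
    by_cases hyρ : ‖y‖ < ρ
    · have h := hS y hy (by linarith)
      simp [hg, hκ, hyρ, h.1, h.2]
    · simp [hg, hκ, hyρ]
  have hP' : ∀ y : E3, ‖y‖ < ρ₂ → ∀ᶠ z in 𝓝 y, g z = D₁.h.inner z ∧ κ z = D₁.k z := by
    intro y hy
    have : ∀ᶠ z in 𝓝 y, ‖z‖ < ρ₂ :=
      (isOpen_lt continuous_norm continuous_const).mem_nhds (by simpa using hy)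
    exact this.mono fun z hz ↦ hP z hz
  have hQ' : ∀ y : E3, ρ₁ < ‖y‖ → ∀ᶠ z in 𝓝 y, g z = D₂.h.inner z ∧ κ z = D₂.k z := by
    intro y hy
    have : ∀ᶠ z in 𝓝 y, ρ₁ < ‖z‖ :=
      (isOpen_lt continuous_const continuous_norm).mem_nhds (by simpa using hy)
    exact this.mono fun z hz ↦ hQ z hz
  -- the pointwise axioms, branch by branch
  have hsymm : ∀ (y : E3) (v w : TangentSpace (𝓡 3) y), g y v w = g y w v := by
    intro y v w
    by_cases hy : ‖y‖ < ρ
    · simp only [hg, hy, if_true]; exact D₁.h.symm y v w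
    · simp only [hg, hy, if_false]; exact D₂.h.symm y v w
  have hpos : ∀ (y : E3) (v : TangentSpace (𝓡 3) y), v ≠ 0 → 0 < g y v v := by
    intro y v hv
    by_cases hy : ‖y‖ < ρ
    · simp only [hg, hy, if_true]; exact D₁.h.pos y v hv
    · simp only [hg, hy, if_false]; exact D₂.h.pos y v hv
  have hbdd : ∀ y : E3, Bornology.IsVonNBounded ℝ {v : TangentSpace (𝓡 3) y | g y v v < 1} := by
    intro y
    by_cases hy : ‖y‖ < ρ
    · simp only [hg, hy, if_true]; exact D₁.h.isVonNBounded y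
    · simp only [hg, hy, if_false]; exact D₂.h.isVonNBounded y
  have hksymm : ∀ (y : E3) (v w : TangentSpace (𝓡 3) y), κ y v w = κ y w v := by
    intro y v w
    by_cases hy : ‖y‖ < ρ
    · simp only [hκ, hy, if_true]; exact D₁.k_symm y v w
    · simp only [hκ, hy, if_false]; exact D₂.k_symm y v w
  -- smoothness is local: near every point the patched sections are those of `D₁` or of `D₂`
  refine ⟨{ h := { inner := g, symm := hsymm, pos := hpos, isVonNBounded := hbdd, contMDiff := ?_ },
            k := κ, k_symm := hksymm, contMDiff_k := ?_ }, ?_, ?_⟩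
  · intro y
    rcases lt_or_ge ‖y‖ ρ₂ with hy | hy
    · refine (D₁.h.contMDiff y).congr_of_eventuallyEq ?_
      exact (hP' y hy).mono fun z hz ↦ by simp only [hz.1]
    · have hy' : ρ₁ < ‖y‖ := by linarith
      refine (D₂.h.contMDiff y).congr_of_eventuallyEq ?_
      exact (hQ' y hy').mono fun z hz ↦ by simp only [hz.1]
  · intro y
    rcases lt_or_ge ‖y‖ ρ₂ with hy | hy
    · refine (D₁.contMDiff_k y).congr_of_eventuallyEq ?_
      exact (hP' y hy).mono fun z hz ↦ by simp only [hz.2]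
    · have hy' : ρ₁ < ‖y‖ := by linarith
      refine (D₂.contMDiff_k y).congr_of_eventuallyEq ?_
      exact (hQ' y hy').mono fun z hz ↦ by simp only [hz.2]
  · intro y hy
    exact hP y hy
  · intro y hy
    exact hQ y hy

end InitialDataSet

/-! ## §2 Assembly of the conclusion of the fact from a glued datum on `ℝ³` -/

namespace MaoOhTao

open InitialDataSet

/-- **Assembly of the conclusion of `ObstructionFreeAnnularGluing` from a glued datum on `ℝ³`.** If `Dmid` is a smooth
datum on `ℝ³` solving the vacuum constraints on `{1 < |x| < 64}` which has the sections of `Din` on the open annulus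
`A_1 = {1 < |x| < 2}` and those of `Dout` on `A_32 = {32 < |x| < 64}` — the output `(g, k)` of Mao–Oh–Tao's Thm 1.7 with
Rem 1.9, (1.21), read on `ℝ³` — then patching `Dmid` with `Dout` at radius `48` and the result with `Din` at radius `3/2`
(`exists_patch`) gives a datum which IS `Din` on `B_2`, IS `Dout` outside `B̄_32`, and coincides with `Dmid` near every
point of `{1 < |x| < 64}`, hence solves the constraints there (`VacOn.congr`). This is exactly the last step of the
rendering of Thm 1.7 chosen in `ObstructionFreeAnnularGluing`. [cite: MaoOhTao2023, Thm 1.7 and Rem 1.9] -/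
theorem assembly {Din Dout Dmid : InitialDataSet (𝓡 3) E3} (hV : Dmid.VacOn 1 64)
    (hin : ∀ y : E3, 1 < ‖y‖ → ‖y‖ < 2 → Dmid.SameAt Din y)
    (hout : ∀ y : E3, 32 < ‖y‖ → ‖y‖ < 64 → Dmid.SameAt Dout y) :
    ∃ D : InitialDataSet (𝓡 3) E3,
      D.VacOn 1 64 ∧ (∀ y : E3, ‖y‖ < 2 → D.SameAt Din y) ∧ (∀ y : E3, 32 < ‖y‖ → D.SameAt Dout y) := by
  obtain ⟨S, hS1, hS2⟩ :=
    exists_patch Dmid Dout (ρ₁ := 32) (ρ := 48) (ρ₂ := 64) (by norm_num) (by norm_num) hout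
  have hDS : ∀ y : E3, 1 < ‖y‖ → ‖y‖ < 2 → Din.SameAt S y := fun y h1 h2 ↦
    ((hS1 y (by linarith)).trans (hin y h1 h2)).symm
  obtain ⟨D, hD1, hD2⟩ :=
    exists_patch Din S (ρ₁ := 1) (ρ := 3 / 2) (ρ₂ := 2) (by norm_num) (by norm_num) hDS
  refine ⟨D, ?_, hD1, fun y hy ↦ (hD2 y (by linarith)).trans (hS2 y hy)⟩
  refine hV.congr fun y h1 h2 ↦ ?_
  exact (eventually_norm_mem_Ioo h1 h2).mono fun z hz ↦ (hD2 z hz.1).trans (hS1 z hz.2)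

/-! ## §3 Non-vacuity of the bump hypothesis -/

section Bump

open _root_.MeasureTheory _root_.Set

/-- **Admissible bumps exist**: there is `η ∈ C^∞(ℝ)` with `η = 0` on `(−∞, 1] ∪ [2, ∞)` and `∫ η = 1` (the fixed bump
of Mao–Oh–Tao §1.2, "Fix `η ∈ C_c^∞(0, ∞)` such that `supp η ⊆ (1, 2)`, `∫ η = 1`"; here
`η = φ / ∫ φ` with `φ(s) = expNegInvGlue(s − 1) · expNegInvGlue(2 − s)`, positive exactly on `(1, 2)`), so the hypothesis
`IsBump η` of `ObstructionFreeAnnularGluing` is inhabited. [cite: MaoOhTao2023, §1.2] -/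
theorem exists_isBump : ∃ η : ℝ → ℝ, IsBump η := by
  set φ : ℝ → ℝ := fun s ↦ expNegInvGlue (s - 1) * expNegInvGlue (2 - s) with hφ
  have hφc : ContDiff ℝ ∞ φ :=
    (expNegInvGlue.contDiff.comp (contDiff_id.sub contDiff_const)).mul
      (expNegInvGlue.contDiff.comp (contDiff_const.sub contDiff_id))
  have hφ1 : ∀ s, s ≤ 1 → φ s = 0 := fun s hs ↦ by
    simp [hφ, expNegInvGlue.zero_of_nonpos (sub_nonpos.2 hs)]
  have hφ2 : ∀ s, 2 ≤ s → φ s = 0 := fun s hs ↦ by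
    simp [hφ, expNegInvGlue.zero_of_nonpos (sub_nonpos.2 hs)]
  have hφnn : ∀ s, 0 ≤ φ s := fun s ↦ mul_nonneg (expNegInvGlue.nonneg _) (expNegInvGlue.nonneg _)
  have hφpos : ∀ s, 1 < s → s < 2 → 0 < φ s := fun s h1 h2 ↦
    mul_pos (expNegInvGlue.pos_of_pos (by linarith)) (expNegInvGlue.pos_of_pos (by linarith))
  have hsupp : Function.support φ = Ioo 1 2 := by
    ext s
    simp only [Function.mem_support, mem_Ioo]
    constructor
    · intro h
      constructor
      · by_contra h'
        exact h (hφ1 s (not_lt.1 h'))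
      · by_contra h'
        exact h (hφ2 s (not_lt.1 h'))
    · rintro ⟨h1, h2⟩
      exact (hφpos s h1 h2).ne'
  have hcs : HasCompactSupport φ := by
    refine HasCompactSupport.intro (isCompact_Icc (a := (1:ℝ)) (b := 2)) fun s hs ↦ ?_
    rw [mem_Icc, not_and_or, not_le, not_le] at hs
    rcases hs with h | h
    · exact hφ1 s h.le
    · exact hφ2 s h.le
  have hint : Integrable φ := hφc.continuous.integrable_of_hasCompactSupport hcs
  have hIpos : 0 < ∫ s, φ s := by
    rw [integral_pos_iff_support_of_nonneg (fun s ↦ hφnn s) hint, hsupp]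
    simp
  refine ⟨fun s ↦ (∫ t, φ t)⁻¹ * φ s, contDiff_const.mul hφc, ?_, ?_, ?_⟩
  · intro s hs
    simp [hφ1 s hs]
  · intro s hs
    simp [hφ2 s hs]
  · rw [integral_const_mul, inv_mul_cancel₀ hIpos.ne']

end Bump

end MaoOhTao

end Literature.Geometry.Lorentzian

end
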